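import Literature.NumberTheory.EllipticCurves.Kato2004.EllipticUnitZetaClassComparison
import HarnessLib

/-!
# Kato 2004 (Astérisque 295) (15.16.1) WITH THE CONSTANT NAMED — `F-P1-EXACT`: the comparison constant of `F-P1`
# (`CM.kato15161_ellipticUnitClass_res_zetaFamily`, p821323) is a `𝔭`-ADIC UNIT times the closed period ratio
# `p^{e}/κ′_W`, `ι(κ′_W)·Ω_W = ι(√−p)·λ₀` (`λ₀` = the `O_K`-generator of the Néron lattice of `W`), stated in NORM form

Topic `NumberTheory/EllipticCurves`, sub-directory `Kato2004`, namespace `…Kato2004.CM`.  ONE named fact (`def … : Prop`, D-0014: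
nothing asserted, no `_holds`; PUBLISHED: Kato (15.16.1) — an EXACT identity at the `V`-level — with Thm. 12.5 (1), Lemma 15.11 (2),
Prop. 15.9, §13.9/Lemma 13.10 (1), i.e. exactly the sources of `F-P1` plus Lemma 15.11 (2) for the period definition of the transport
(15.11.3)); nothing else is declared.  No instance, no notation, no `sorry`.
Typed by seat `bsd-cm-k-ty1` g36 (literature-prover, cell bsd-cm) as the pen's (P-1) «F-P1-EXACT typer» (STATUS D1152 brief
`bsd-cm-plan/WAKE-P1-FP1-EXACT.md` v2 a638c9a003ab70ff; D1158 GO; critic idea-crit-15 NOTE #28 items 7–8), after the reading note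
`pub/bsd-cm/bsd-cm-k-ty1/g36/P1-READING-NOTE.md` 84283c59bac7d9e2 (symbol table s1–s10, Σ-covariance table (g1)–(g10)).
Consumer (Summits side, nothing of it asserted here): crux `EllipticUnitValueSevenOfGZK` = stmt-BirchSwinnertonDyer-19945, research stub (S-★′)
`stub_periodPositionLawSeven` of `Cruxes/EllipticUnitValueSevenOfGZK/Lines/kato_perrin_riou_zp.lean` v22 (l.985): by the (F-b) table
(`Cruxes/…/Ideas/fb-table-g89.md` §1) every solution of the `hZ` law has `J := v₇(α₀′² + 7α₁′²) − 2e′ = 2k + δ` with `δ := 2e + 2t − jα`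
read off `F-P1`'s constant; the clause (E) below says **`δ = v_p(Nm_{K/ℚ} κ′_W)`**, so (S-★′) ⟺ LEMMA P `v₇(Nm κ′_W) ≤ a_W` — the
valuation of ONE closed element of `K`, i.e. the real/imaginary TYPE of the Néron lattice (the pen's (P-2); NOT asserted here).

## What is new relative to `F-P1` (p821323) — and why `F-P1′` (p825229) cannot carry it

`F-P1` binds its comparison constant existentially: `∃ (t : ℕ) (α₀ α₁ : ℤ_p) (w ∈ Λˣ)`.  On the objects the tree quantifies over, NOTHING
FINER THAN ONE INTEGER is well defined (Σ-covariance table, reading note §2): (g1) the Kummer frame's torsion generator `e` is any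
`O_K ⊗ ℤ_p`-generator of `T_p(W_K)` (the consumer's `good`), and `e ↦ ε·e`, `ε ∈ (O_K ⊗ ℤ_p)ˣ`, multiplies the elliptic-unit class by `ε`
(`O_K`-linearity of the Kummer cup product); (g4) the `ℚ`-side class is pinned up to `Λˣ`; (g2) the value gauge `(Ω, 𝔏, y) ↦ (r⁻¹Ω, r𝔏, ry)`,
`r ∈ K^×`, of `EllipticZetaBody` (Z3)–(Z5) makes every letter written through a frame's period `Ω` gauge-DEPENDENT — whereas `F-P1`'s
class identity has no `Ω` in it.  The one invariant is the class of `p^{−t}(α₀ + α₁φ)·p^{−e}` in `K_𝔭ˣ/(O_K ⊗ ℤ_p)ˣ`, and **`e` is an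
invariant only under the Néron normalisation (A2)** ((g5): with (A2) deleted, as in `F-P1′`, the datum `(d, q)` of the realised family
moves by `(λd, λ⁻¹q)`, `λ ∈ ℚ^×`, which shifts `e = v_p(perRatio/(q·q⁻))` while `y, t, α` stay) — so the exact letter is `F-P1` (WITH
(A2)) plus a clause, not `F-P1′` plus a clause (pen D1152 §3 (c); critic NOTE #25 (5)(d)).  The clause: for a frame whose `e` is a
GENERATOR (`φ(e₁) ≠ 0`, `e₁ = F.e 1`; `W[𝔭] = ker φ|_{W[p]} = 𝔭T/pT`) and `φ ∘ φ = [−p]` (`𝔭 = (φ)` ramified, `Nm(α₀ + α₁φ) = α₀² + pα₁²`),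
  **(★E)  `p^{−t}·(α₀ + α₁φ) · p^{−e} · κ′_W ∈ (O_K ⊗ ℤ_p)ˣ`**  — stated below in NORM form  **(E) `v_p(α₀² + pα₁²) = 2t + 2e − v_p(Nm_{K/ℚ} κ′_W)`**
((★E) ⇒ (E) at every `p`; at the ramified `𝔭` they are equivalent), where **`κ′_W ∈ K^×` is CLOSED**: `ι(κ′_W)·Ω_W = ι(s)·λ₀` with
`s² = −p`, `Λ_W = λ₀·ι(O_K)` the Néron lattice of the (globally minimal) model (`IsNeronLatticeOf (W.baseChange ℂ) L`, `L.lattice`; class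
number one), `Ω_W = W.realPeriodRat = c_∞·Ω₁` (`Ω₁` = least positive real period, `RealPeriod.lean`).  Since `Λ̄_W = Λ_W` and
`O_K^× = {±1}` for `p ≥ 7`, `λ₀ ∈ ℝ ∪ iℝ`: REAL type `λ₀ = ±Ω₁` gives `κ′_W = ±s/c_∞`, `v_p(Nm κ′_W) = 1`; IMAGINARY type `λ₀ = ±iΩ′`,
`Ω₁ = Ω′√p`, gives `κ′_W = ∓1/c_∞`, `v_p(Nm κ′_W) = 0` — which type a given curve has is NOT asserted (it is the consumer's LEMMA P; cf.
`Cruxes/EllipticUnitValueSevenOfGZK/DivisibilityKernel-g64.md` §4–§4bis, where the same integer is derived in cohomology and censused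
numerically at 32 members of `𝒞₇`).

## The printed statements (K. Kato, Astérisque 295 (2004); `[p. N]` = printed page = store `paper:doi-10-24033-ast-639` PDF page `N − 115`;
## re-read 2026-08-31 by this seat: p0106–p0107, p0140–p0152)

* **Thm. 12.5 (1) [p. 221]** "There exists a unique `F_λ`-linear map `V_{F_λ}(f) → 𝐇¹(V_{F_λ}(f)); γ ↦ z_γ^{(p)}` having the following
  property: … sends the image of `z_γ^{(p)}` … to `L_{(p)}(f, χ, r)·(2πi)^{k−r−1}·γ^±` … `± = (−1)^{k−r−1}χ(−1)` … We have
  `z^{(p)}_{ι(γ)} = σ_{−1}·z^{(p)}_γ`."  [On the `Δ`-trivial component only `γ⁺` is seen: `z_{γ′} = c·z_δ` there, for `γ′⁺ = c·δ`, `δ` a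
  generator of `T⁺`, `c ∈ L_λ`.]
* **Lemma 15.11 (2) [pp. 261–262]** "… denote the composite `S(ψ) → V_L(ψ) ↪ V_L(ψ)~` also by `per_ψ`. Then there exists a unique
  isomorphism of representations of `Gal(ℂ/ℝ)` over `L` **(15.11.3)** `V_L(ψ)~ ≅ V_L(f)` for which the diagram [`per_ψ`, `per_f`, (15.11.1)]
  is commutative"; proof: "It is sufficient to show that there exists an isomorphism … `h` such that `h ∘ per_ψ^± = per_f^±`."
  [p. 262, last lines] "In the rest of §15, we fix an isomorphism (15.11.1). … We also identify the representations `V_{L_λ}(ψ)~` and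
  `V_{L_λ}(f)` … via (15.11.2)"; [p. 263 l. 1–9] the caveat on (15.11.3) vs (15.11.2) concerns `k ≥ 3` (Kuga–Sato vs CM motive).
* **§15.8 (15.8.1), Prop. 15.9 / (15.9.1) [pp. 257–259]** (the period map `per_ψ : S(ψ) → V_ℂ(ψ)`; the values of the elliptic units:
  "… is an element of `S(ψ) ⊗_K K′` whose image under `Σ_σ χ(σ) per_ψ ∘ σ` coincides with `L_{p𝔣}(ψ̄, χ, r)·γ`") — in a coordinate `ω` of
  `S(ψ)` with `per_ψ(ω) = Ω(γ)·γ` the value is `Ω(γ)⁻¹·L_{p𝔣}(ψ̄, χ, 1)` (the tree's (Z5), `h159′`).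
* **§15.16 (15.16.1) [p. 265 l. 30–37]** "By (15.12.2) and Thm. 12.4 (2), we have: Let `γ ∈ V_L(ψ)` and let `γ′` be the image of `γ` in
  `V_L(f)` under (15.11.3). Then the homomorphism (15.12.1) sends `z_{p^∞𝔣} ⊗ γ ⊗ (ζ_{pⁿ})_n^{⊗(−1)}` to `z^{(p)}_{γ′}`."  [An EXACT
  identity in `𝐇¹(V_{L_λ}(f))`, no constant.  §15.16 opens "in the case `K` is not contained in `ℚ(ζ_{p^∞})`"; its derivation
  «(15.12.2) + Thm. 12.4 (2)» is case-free (§15.15 proves 12.4 in both cases), and Prop. 15.17's proof ends "The proof for the case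
  `K ⊂ ℚ(ζ_{p^∞})` goes similarly by using 15.14 instead of 15.13" (p. 265 l. 52): the SCOPE caveat already carried by `F-P1`.]
* **§13.9 [p. 230 l. 8–9], Lemma 13.10 (1) [p. 230], Ex. 13.3 [pp. 224–225]** — the realised family's position `M̃·𝐳_{γ_W} = u·p^e·y`,
  `e = v_p(perRatio/(q·q⁻))` (the tree's (A5′)/(A6′); module docstring of `Kato2004/AdmissibleZetaClass.lean`, «WHY THIS IS KATO'S ELEMENT»).

## Derivation of (E), line by line (cert item 1 of brief v3; Kato's own proof of (15.16.1) = «(15.12.2) and Thm. 12.4 (2)»: compare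
## VALUES on the rank-one line).  `[p. N lM]` = printed page / line of Astérisque 295; (Dk) = step k.

(D1) [§15.6 (15.6.1)–(15.6.3), p. 254] `z_{p^∞𝔣}` is canonical and `(_𝔟z) = (N𝔟 − σ_𝔟)·z_{p^∞𝔣}`: the elliptic-unit side has NO free scalar;
     the tree's unit towers are pinned to `_𝔟z_{p^s𝔣}` by `IsKatoUnitRepAt` (`F-P1`'s binder).
(D2) [§15.12 (15.12.1), p. 263 l14–24; 15.14, p. 264] the map is «Kummer class of the unit, cup product with the element of `T(−1)`,
     corestriction», for «`T` ANY `Gal(ℚ̄/K)`-stable `O_λ`-lattice»; the tree's column twists by the frame's `e = (e_k) ∈ T_p(W_K)` (HOMOLOGY)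
     and Kato's cohomological vector is `γ = e ⊗ ζ^{⊗(−1)}` under `T_pW(−1) ≅ H¹_ét` (Weil pairing; `F-P1` memo (F1)/(F3): the Tate twist on
     both sides cancels the `ζ^{⊗(−1)}`).  This isomorphism is `O_𝔭`-SEMILINEAR and perfect, so `e` generates `T_p(W_K)` over `O_K ⊗ ℤ_p` iff
     `γ` generates `H¹_ét` — the letter's `(hgen)`; a change `e ↦ ε·e`, `ε ∈ (O_K ⊗ ℤ_p)ˣ`, multiplies the class by `ε` (cup product is
     `O_K`-linear) — Σ-table (g1).
(D3) [Prop. 15.9 / (15.9.1), pp. 258–259; §15.8 (15.8.1), p. 257] the `exp*` of the class of `(_𝔟z) ⊗ γ` at a layer `K′`, read in a coordinate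
     `ω` of `S(ψ)` with `per_ψ(ω) = Ω(γ)·γ`, has character sums `(N𝔟 − ψ(𝔟)χ(𝔟)⁻¹)·Ω(γ)⁻¹·L_{p𝔣}(ψ̄, χ, 1)` (= the tree's (Z5) of `h159′`).
(D4) [Thm. 12.5 (1), p. 221; §13.9, p. 230 l8–9; Lemma 13.10 (1), p. 230; Ex. 13.3, pp. 224–225] the `ℚ`-side: on the `Δ`-trivial component
     Kato's `z_γ` sees `γ⁺` only (`z_{ιγ} = σ_{−1}z_γ`), its values are `L_{(p)}(f, χ, 1)·γ⁺`, i.e. `L_{(p)}(W, χ̄, 1)·(Gauss)/Ω_W` in the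
     coordinate `ω_W` for the tree's `𝐳_{γ_W}` (`Ω_W = W.realPeriodRat = 2c_∞·Ω_+`, a `p`-unit multiple of Kato's `Ω_+`, `p` odd), and the
     realised family sits at `M̃·𝐳_{γ_W} = u·p^e·y` with `e = v_p(perRatio/(q·q⁻))` — `F-P1`'s (A5′)/(A6′) binders, MEANINGFUL BECAUSE (A2) pins
     the coordinate `d` to the Néron differential up to `ℤ_pˣ` (Σ-table (g5); `AdmissibleZetaClass.lean` «SCALE AUDIT»).  Hence `res y` has
     values `p^{−e}·ρ_χ(u⁻¹M̃)·(unit)·L_{(p)}(W, χ̄, 1)/Ω_W`.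
(D5) [`F-P1`'s support hypothesis; Prop. 15.9 p. 258 «𝔞 ranges over all ideals prime to p𝔣» vs Thm. 12.5 (1) `L_{(p)}`] the two depleted
     `L`-values agree at every `χ` of `p`-power conductor.
(D6) [Thm. 12.4 (2), p. 221, proved for CM forms in BOTH cases in §15.15, p. 265 l1–18; Thm. 12.5 (2); §15.16 (15.16.1), p. 265 l30–37]
     `𝐇¹ ⊗ ℚ` is free of rank one and the values (D3)/(D4) are non-zero for almost all `χ`, so the class ratio IS the value ratio: this is the
     sentence «By (15.12.2) and Thm. 12.4 (2), we have (15.16.1)» — `EU(γ) = z_{γ′}` EXACTLY, `γ′ = (15.11.3)γ` [Lemma 15.11 (2), pp. 261–262: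
     `h ∘ per_ψ^± = per_f^±`; in the tree's currency `V(ψ)` and `V(f)` are both `H¹` of the SAME `W` and (15.11.1)/(15.11.2) are the identity on
     `ω_W` / `H¹_ét(W)` — canonical base change `T_pW∣_{G_K} = T_p(W_K)`, Σ-table (g7)].  Reading `F-P1`'s identity
     `[ε_𝔟]·(p^t M̃)·euK 𝔟 = N𝔟·([ε_𝔟] − N_bσ_𝔟)·(α₀ + α₁φ)·w·res y` through (D3)/(D4)/(D5):
     `p^{−t}·(α₀ + α₁φ)·ρ(w)·(units) = p^{e}·Ω_W/Ω(γ)` for every `χ`, i.e. **`p^{−t}(α₀ + α₁φ)·p^{−e}·(Ω(γ)/Ω_W) ∈ (O_K ⊗ ℤ_p)ˣ`.**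
(D7) [the antecedent `hκ′` + the period identity below] for a Betti generator `γ = PD(λ₀)`: `Ω(γ)/Ω_W = √−p·λ₀/Ω_W = ι(κ′_W)`, which is (★E);
     by (D2) the same holds for every generator `e` of the frame.  Taking norms `K_𝔭 → ℚ_p` (`Nm(α₀ + α₁φ) = (α₀ + α₁φ)(α₀ − α₁φ) = α₀² + pα₁²`;
     units have unit norm): **(E) `v_p(α₀² + pα₁²) − 2t − 2e + v_p(Nm_{K/ℚ} κ′_W) = 0`.**

## The period identity `Ω(PD λ₀) = (τ₀ − τ̄₀)·λ₀ = √−p·λ₀` [folklore — linear algebra of the de Rham class; the ONE non-Kato step (cert item 9);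
## it enters the letter ONLY through the definitional antecedent `hκ′`]

Let `Λ_W = λ₀·O_K` with oriented basis `e₁ = λ₀`, `e₂ = λ₀τ₀`, `τ₀ = (1 + √−p)/2` (`Im τ₀ > 0`), dual basis `e₁^∨, e₂^∨` of `H¹(W(ℂ), ℤ) =
Hom(Λ_W, ℤ)`, Poincaré dual `PD(e₁) = ⟨e₁, ·⟩ = e₂^∨` (`⟨e₁, e₂⟩ = 1`).  The de Rham classes are `[ω] = Σᵢ(∫_{eᵢ}ω)·eᵢ^∨ = λ₀(e₁^∨ + τ₀e₂^∨)`,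
`[ω̄] = λ̄₀(e₁^∨ + τ̄₀e₂^∨)`.  Writing `e₂^∨ = x[ω] + y[ω̄]`: `xλ₀ + yλ̄₀ = 0` and `xλ₀τ₀ + yλ̄₀τ̄₀ = 1`, so `xλ₀(τ₀ − τ̄₀) = 1`; the `ψ`-component
(`H^{1,0}`-projection) of `PD(λ₀) = e₂^∨` is `x[ω]`, i.e. `per_ψ(ω) = [ω] = x⁻¹·e_ψ(PD λ₀)`: **`Ω(PD λ₀) = x⁻¹ = (τ₀ − τ̄₀)·λ₀ = √−p·λ₀`**
(the factor `√−p` generates the different `𝔡_{O_K/ℤ}`: Poincaré duality differs from the dual basis by it; cf. the ERRATUM REV 1 → REV 1.1 of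
`DivisibilityKernel-g64.md` §4, same computation in cohomology).  Consequently, with `Ω_W = c_∞·Ω₁` (`Ω₁` = least positive real element of
`Λ_W`, `RealPeriod.lean`/`exists_periodPair_realPeriod_eq`) and `λ₀ ∈ ℝ ∪ iℝ` (`Λ̄_W = Λ_W`, `O_K^× = ±1`):
  REAL type `λ₀ = ±Ω₁`:            `ι(κ′_W) = √−p·(±Ω₁)/(c_∞Ω₁) = ±ι(s)/c_∞`,  `κ′_W = ±s/c_∞`,  `Nm κ′_W = p/c_∞²`,  **`v_p(Nm κ′_W) = 1`**;
  IMAGINARY type `λ₀ = ±iΩ′` (then `Ω₁ = Ω′√p`): `ι(κ′_W) = i√p·(±iΩ′)/(c_∞Ω′√p) = ∓1/c_∞`,  `κ′_W = ∓1/c_∞ ∈ ℚ`,  `Nm κ′_W = 1/c_∞²`,  **`v_p = 0`**.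
  WORKED CURVES (`p = 7`, `K = ℚ(√−7)`, both `j = −3375`, CM by `O_K`, `c_∞ = 1` since `Δ < 0`; Cremona, *Algorithms* Table 1, N = 49, and the
  cell census `DivisibilityKernel-g64.md` §4bis, pure-python AGM, Néron normalisation):
  · 49a1 = `[1,−1,0,−2,−1]`: `Λ = Ω₁·O_K`, `Ω₁ = Ω_W = 1.933312…` (Cremona: `Ω(f) = 2x`, `x = 0.96666`, `y/x = √7`), REAL type, `λ₀ = Ω₁`,
    `κ′ = √−7`, `Nm κ′ = 7`, `v₇(Nm κ′) = 1`;
  · 49a3 = `[1,−1,0,−107,552]` (= 49a1/49a1[𝔭]): least purely imaginary period `λ₀ = 0.730722…·i`, `Ω₁ = Ω_W = 1.933312… = √7·|λ₀|`,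
    IMAGINARY type, `κ′ = i√7·0.730722i/1.933312 = −1`, `Nm κ′ = 1`, `v₇(Nm κ′) = 0`.
  (The `𝒞₇` members are the twists `E_{D,i}` with `D < 0`; twisting by `D < 0` exchanges the two types — `Λ_{W^{(D)}} ∼ Λ_W/√D` — so
  `E_{D,1} = 49a1^{(D)}` is IMAGINARY and `E_{D,3}` REAL: the census's «`a = 0` at `E_{D,1}, E_{D,2}`; `a = 1` at `E_{D,3}, E_{D,4}`».  Which type a
  given curve has is NOT part of this fact — it is the consumer's LEMMA P.)

SCOPE / HONEST LABEL.  Stated, like `F-P1`, for `W/ℚ` globally minimal with CM by the MAXIMAL order and the admissible `(K, ψ, ι, f)` of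
`h159′`, now with `φ ∘ φ = [−p]` (`K = ℚ(√−p)`, `p` the ramified CM prime; the consumer's `(p, j) = (7, −3375)`); `W.j ∈ maximalCMJInvariants`
with `p` ramified and `p ≠ 2` leave `p ∈ {3, 7, 11, 19, 43, 67, 163}`; at `p = 3` (`j = 0`, `O_K^× = μ₆`) the generator `λ₀` is defined up
to `μ₆` — units; (E) unchanged.  The VALUE of `v_p(Nm κ′_W)` (the lattice type) is NOT asserted.  Nothing at `π` is asserted beyond what
(★E) says about `F-P1`'s OWN constant; Kato's (15.16.1) is printed for `K ⊄ ℚ(ζ_{p^∞})` and asserted «similarly by 15.14» otherwise (as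
in `F-P1`).  The member-level form (a non-maximal order `O` with `O ⊗ ℤ_p = O_K ⊗ ℤ_p`, column read through a prime-to-`p` isogeny
`T_pα`; pen D1152 §3 (b)) is NOT typed here: (E) transports along a `ℚ`-isogeny of degree prime to `p` without change (`jα`, `t` fixed
under the unit `deg`; `e_W = e_{W₂}` since `Ω_W/Ω_{W₂} ∈ 2^ℤ`; lattice type preserved), but the (A2) clause this letter must keep does
not yet transport by kernel (cell STATUS D1147).
-- TODO(general form): split / inert `p` (state (★E) prime by prime of `O_K ⊗ ℤ_p`; the norm form (E) then loses information at split `p`);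
-- member + lattice level (pen D1152 §3 (b)); weight `k ≥ 3`.

WHAT THIS IS NOT: not a construction of Kato's `γ ↦ z_γ` or of (15.11.3); not a statement about a frame's period `Ω`/value datum `𝔏`
(gauge, (g2)); not LEMMA P (the lattice type per curve); not the integral comparison K2ᶜ in any currency other than `F-P1`'s own
constant; nothing about Conj. 12.10 or BSD; no summit statement touched.  `F-P1` (p821323) is the projection of this fact forgetting (E)
on the sub-family of data `(m = −p, φ(e₁) ≠ 0, Betti antecedents inhabited)`; `F-P1′` (p825229) is weaker still.

## References

* [Kato2004Asterisque] K. Kato, *p-adic Hodge theory and values of zeta functions of modular forms*, Astérisque 295 (2004): Thm. 12.4 (2),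
  Thm. 12.5 (1)–(2) (pp. 221–222), §13.9 (p. 230 l. 8–9), Lemma 13.10 (1) (p. 230), Ex. 13.3 (pp. 224–225), §15.6 (15.6.1)–(15.6.3) (p. 254),
  §15.8 (15.8.1) (p. 257), Prop. 15.9 / (15.9.1) (pp. 258–259), Lemma 15.11 (1)–(2) with (15.11.1)–(15.11.3) (pp. 260–262), §15.12
  (15.12.1)–(15.12.2) (p. 263), 15.13–15.14 (p. 264), §15.15–15.16 (15.16.1) and Prop. 15.17 (p. 265).
* [BurungaleFlach2024] A. Burungale, M. Flach, Camb. J. Math. 12 (2024) = arXiv:2206.09874, §1 p. 3 (the elliptic-unit side's period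
  bookkeeping `⊗_v H₁(E(F_v), ℤ) = Ω·𝔞(Ω)·det Hom(H⁰(ℰ, Ω¹), O_F)` — consistent with `Λ_W = λ₀·O_K`; not load-bearing).
* [SilvermanAEC2009] J. H. Silverman, *The Arithmetic of Elliptic Curves*, Thm. VI.5.1 / Prop. VI.3.6 (b) (the Néron lattice; tree
  `IsNeronLatticeOf`), C.16 (the real period); [CremonaAlgorithms1997] J. E. Cremona, §3.7 (`Ω = c_∞·Ω₁`; tree `RealPeriod.lean`).
* Tree: `Kato2004/EllipticUnitZetaClassComparison.lean` (`F-P1`, whose module docstring is the text of record for every binder repeated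
  below), `Kato2004/AdmissibleZetaClass.lean`, `Kato2004/EllipticUnitKummerCupValues.lean` (`h159′`), `Kato2004/EllipticZetaReciprocity.lean`
  (`EllipticZetaBody`), `ModularCurve.lean` (`IsNeronLatticeOf`), `RealPeriod.lean` / `BSDInvariants.lean` (`realPeriodRat`).
  Cell records: pen D1130, D1147–D1149, D1152, D1158; critic NOTEs #13 (ii), #17, #25, #28; `Cruxes/EllipticUnitValueSevenOfGZK/Ideas/fb-table-g89.md`;
  `Cruxes/EllipticUnitValueSevenOfGZK/DivisibilityKernel-g64.md` §3–§4bis; reading note `pub/bsd-cm/bsd-cm-k-ty1/g36/P1-READING-NOTE.md`.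
-/

noncomputable section

open scoped BigOperators NumberField TensorProduct Classical
open Field IsDedekindDomain NumberField CongruenceSubgroup ValuativeRel
open Literature.NumberTheory.GaloisRepresentations
open Literature.NumberTheory.GaloisRepresentations.PeriodRingData
open Literature.NumberTheory.GaloisRepresentations.IsNonarchimedeanLocalField
open Literature.NumberTheory.PAdicHodge
open Literature.NumberTheory.EllipticCurves Literature.NumberTheory.EllipticCurves.ModularForms
open Literature.NumberTheory.AdelicBaseChange Literature.NumberTheory.Automorphic
open Literature.NumberTheory.ComplexMultiplication.EllipticUnits
open WeierstrassCurve (geomPoints geomTorsion)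

namespace Literature.NumberTheory.EllipticCurves.Kato2004

open EulerSystemValues Rat.HeightOneSpectrum

namespace CM

/-! ## The named fact `F-P1-EXACT` -/

set_option backward.isDefEq.respectTransparency false in
/-- **Kato 2004, (15.16.1) with the constant named — `F-P1-EXACT`.**  Binders: EXACTLY those of `F-P1`
(`kato15161_ellipticUnitClass_res_zetaFamily`, p821323: `W/ℚ` globally minimal with CM by the maximal order of `K`, the admissible
`(ψ, ι, f)` of `h159′`, the support condition on `f`, a prime `p ≠ 2`, the `ℚ`-side pin `(κ, γ, I)`, the `K`-side pin `(h, γK, IK)`, a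
Kummer frame `F` on the ray-class tower with `e ≠ 0` and `hV`, the CM endomorphism `φ` with `φ ∘ φ = [m]`, `m < 0`, and ONE realised
value-pinned family (A0)–(A6′) INCLUDING the Néron normalisation (A2)) PLUS: `m = −p` (the ramified CM prime, `𝔭 = (φ)`); the frame's
`e₁ = F.e 1` satisfies `φ(e₁) ≠ 0` (`e` is an `O_K ⊗ ℤ_p`-GENERATOR of `T_p(W_K)`); and the Betti antecedents DEFINING the closed constant
`κ′ ∈ K^×` — a Néron lattice `L` of `W ⊗ ℂ` (`IsNeronLatticeOf`), an `O_K`-generator `λ₀` of `L.lattice` (`Λ_W = λ₀·ι(O_K)`), `s ∈ K` with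
`s² = −p`, and `ι(κ′)·Ω_W = ι(s)·λ₀` (`Ω_W = W.realPeriodRat`).  CONCLUSION: there are `t ∈ ℕ`, `(α₀, α₁) ∈ ℤ_p² ∖ {0}`, `w ∈ Λˣ` with
`F-P1`'s twisted class identity VERBATIM (for every `𝔟` prime to `6pf`, every pinned unit tower, all coordinates `(b₀, b₁, N_b)` of the
Artin symbols on the `e_k`) **AND the exact clause (E) `v_p(α₀² + p·α₁²) = 2t + 2e − v_p(Nm_{K/ℚ} κ′)`** — Kato's (15.16.1) is EXACT
(«(15.12.1) sends `z_{p^∞𝔣} ⊗ γ ⊗ ζ^{⊗(−1)}` to `z_{γ′}`», `γ′ = (15.11.3)γ`, `h ∘ per_ψ^± = per_f^±`), so the constant is a `𝔭`-adic unit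
times `p^{e}·Ω_W/Ω(γ)` with `Ω(PD λ₀) = √−p·λ₀` (module docstring «How (★E) is read off the print»).  NOT asserted: the value of
`v_p(Nm κ′)` (the real/imaginary type of `Λ_W` — the consumer's LEMMA P), any member-level form, anything at split/inert `p`.  Named fact;
nothing asserted; no `_holds` expected (size XL).
[cite: Kato2004Asterisque, §15.16 (15.16.1) (p. 265 l. 30–37), Lemma 15.11 (2) with (15.11.3) (pp. 261–262), Prop. 15.9 / (15.9.1) (pp. 258–259), §15.8 (15.8.1) (p. 257), Thm. 12.5 (1) (p. 221), Thm. 12.4 (2) (p. 221), §13.9 (p. 230 l. 8–9), Lemma 13.10 (1) (p. 230), §15.6 (15.6.1)–(15.6.3) (p. 254), §15.12 (15.12.1) (p. 263), 15.14 (p. 264), Prop. 15.17 proof, last line (p. 265)]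
[cite: SilvermanAEC2009, Thm. VI.5.1 and Prop. VI.3.6 (b)] [cite: CremonaAlgorithms1997, §3.7] -/
def kato15161_ellipticUnitClass_res_zetaFamily_exact : Prop :=
  ∀ (W : WeierstrassCurve ℚ) [W.IsElliptic] [W.IsGloballyMinimal], W.j ∈ maximalCMJInvariants →
  ∀ (K : Type) [Field K] [NumberField K], IsCMFieldOfJ K W.j →
  ∀ (ψ : HeckeCharacter K), ψ.HasInfinityType (fun _ ↦ 1) (fun _ ↦ 0) →
    (∀ s : ℂ, 3 / 2 < s.re → heckeLFunction ψ s = W.LSeries s) →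
  ∀ (ι : AlgebraicClosure K →+* ℂ),
    (∀ (w : InfinitePlace K) (x : K), ι (algebraMap K (AlgebraicClosure K) x) = w.embedding x) →
  ∀ (f : ℕ), 3 ≤ f →
    (∀ α : 𝓞 K, α ≠ 0 → ((f : ℕ) : 𝓞 K) ∣ α - 1 →
      heckeCharIdealValue ψ (Ideal.span {α}) = ι (algebraMap K (AlgebraicClosure K) (α : K))) →
  ∀ (p : ℕ) [Fact p.Prime] [ContinuousSMul ℤ_[p] (W.tateModule p)]
    [ContinuousSMul ℤ_[p] ((W.baseChange K).tateModule p)],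
  -- SUPPORT OF `f`: every prime factor of `f` other than `p` is a prime of BAD reduction of `W` (then `ψ` vanishes at every
  -- prime of `K` dividing `f` and prime to `p`, so Prop. 15.9's `L_{p𝔣}` and Thm. 12.5 (1)'s `L_{(p)}` deplete the same
  -- Euler factors; for a general `f` with `cond ψ ∣ (f)` the two sides below differ by `∏_{𝔩∣f, 𝔩∤p·cond ψ}(1 − ψ̄(𝔩)N𝔩⁻¹σ_𝔩)`)
  (∀ (ℓ : ℕ) [Fact ℓ.Prime], ℓ ∣ f → ℓ ≠ p → ¬ W.HasGoodReductionAtPrime ℓ) →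
  -- the `ℚ`-side pin: a cyclotomic `ℤ_p`-extension of `ℚ`, a topological generator, the Δ-trivial Iwasawa cohomology
  ∀ (κ : ZpExtension ℚ p) (hκ : κ.IsCyclotomic) (γ : absoluteGaloisGroup ℚ) (hγ : κ.IsTopGenerator γ)
    (I : IwasawaH1Data W p κ γ),
  -- the `K`-side pin: the restricted tower `Kℚ_∞/K`, a topological generator, the `K`-side Iwasawa cohomology (15.14)
  ∀ (h : Function.Surjective (κ.toContinuousMonoidHom.comp (absGaloisRestrict ℚ K))) (γK : absoluteGaloisGroup K)
    (hγK : (κ.restrict K h).IsTopGenerator γK) (IK : IwasawaH1DataOver (W.baseChange K) p (κ.restrict K h) γK),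
  -- the Kummer frame on the ray-class tower (as in `h159′`), `e ≠ 0`, and the cyclotomic layers inside the Kummer levels
  ∀ (F : KummerFrame (W.baseChange K) p),
    (∀ s : ℕ, F.V s = torsionLayer (W.baseChange K) (p ^ s * f)) → (∃ k : ℕ, F.e k ≠ 0) →
  ∀ (hV : ∀ n : ℕ, F.V (n + 1) ≤ (κ.restrict K h).layerSubgroup n),
  -- the complex multiplication: a `K`-endomorphism `φ` with `φ ∘ φ = [m]`, `m < 0` (so `ℚ(φ) = K` inside `End ⊗ ℚ`)
  ∀ (φ : WeierstrassCurve.Isogeny (W.baseChange K) (W.baseChange K)) (m : ℤ), m < 0 →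
    (∀ P : geomPoints (W.baseChange K), φ (φ P) = m • P) →
  -- NEW (EXACT): the ramified CM prime — `φ ∘ φ = [−p]`, so `𝔭 = (φ)`, `𝔭² = (p)`, `O_K ⊗ ℤ_p = ℤ_p[φ]`, `Nm(α₀ + α₁φ) = α₀² + p·α₁²`
  m = -(p : ℤ) →
  -- NEW (EXACT): the frame's torsion generator is an `O_K ⊗ ℤ_p`-GENERATOR of `T_p(W_K)` (`e₁ ∉ W[𝔭] = ker φ = 𝔭T/pT`;
  -- the record's `good`); for `e = π^m·ε·γ_gen` the constant below would shift by `π^m` (Σ-table (g1′))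
  φ ((F.e 1 : geomTorsion (W.baseChange K) ((p : ℤ) ^ 1)) : geomPoints (W.baseChange K)) ≠ 0 →
  -- NEW (EXACT): the BETTI antecedents defining the closed constant `κ′_W ∈ K^×` — a Néron lattice `Λ_W = L.lattice` of the
  -- (globally minimal) model, an `O_K`-generator `λ₀` of it (`Λ_W = λ₀·ι(O_K)`; class number one), a square root `s` of `−p`
  -- in `K` (a generator of the different `𝔡_{K/ℚ} = 𝔭`, `p ≡ 3 mod 4`; for `p ≡ 1 mod 4` it is off by the `p`-unit `2`), and
  -- `κ′` with `ι(κ′)·Ω_W = ι(s)·λ₀` (`Ω_W = W.realPeriodRat = c_∞·Ω₁`): PINS ONLY AS ANTECEDENTS (critic NOTE #28 item 8)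
  ∀ (L : PeriodPair), IsNeronLatticeOf (W.baseChange ℂ) L →
  ∀ (lam0 : ℂ), (∀ z : ℂ, z ∈ L.lattice ↔ ∃ a : 𝓞 K, z = lam0 * ι (algebraMap K (AlgebraicClosure K) (a : K))) →
  ∀ (sr : K), sr ^ 2 = -(p : K) →
  ∀ (κ' : K), ι (algebraMap K (AlgebraicClosure K) κ') * ((W.realPeriodRat : ℝ) : ℂ) =
      ι (algebraMap K (AlgebraicClosure K) sr) * lam0 →
  -- ONE REALISED value-pinned family: VERBATIM the binders (A0)–(A4), (A5′), (A6′-scalars) of `HasRealisedZetaFamilyBody`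
  -- (CLOSED form: the `ℤ_p`-structure facts of `T_pW` supplied by the tree theorems, as in `ZetaClassPosition`)
  letI : Module.Free ℤ_[p] (W.tateModule p) := W.module_free_tateModule_holds p
  letI : Module.Finite ℤ_[p] (W.tateModule p) := W.module_finite_tateModule_holds p
  letI ρT := restrictedTateRep W (NumberField.Place.Completion (Sum.inr ((Rat.HeightOneSpectrum.primesEquiv (R := 𝓞 ℚ)).symm ⟨p, Fact.out⟩) : NumberField.Place ℚ)) p
  letI : ValuativeRel (NumberField.Place.Completion (Sum.inr ((Rat.HeightOneSpectrum.primesEquiv (R := 𝓞 ℚ)).symm ⟨p, Fact.out⟩) : NumberField.Place ℚ)) :=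
    inferInstanceAs (ValuativeRel (((Rat.HeightOneSpectrum.primesEquiv (R := 𝓞 ℚ)).symm ⟨p, Fact.out⟩).adicCompletion ℚ))
  letI : TopologicalSpace (NumberField.Place.Completion (Sum.inr ((Rat.HeightOneSpectrum.primesEquiv (R := 𝓞 ℚ)).symm ⟨p, Fact.out⟩) : NumberField.Place ℚ)) :=
    inferInstanceAs (TopologicalSpace (((Rat.HeightOneSpectrum.primesEquiv (R := 𝓞 ℚ)).symm ⟨p, Fact.out⟩).adicCompletion ℚ))
  haveI : IsNonarchimedeanLocalField (NumberField.Place.Completion (Sum.inr ((Rat.HeightOneSpectrum.primesEquiv (R := 𝓞 ℚ)).symm ⟨p, Fact.out⟩) : NumberField.Place ℚ)) :=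
    inferInstanceAs (IsNonarchimedeanLocalField (((Rat.HeightOneSpectrum.primesEquiv (R := 𝓞 ℚ)).symm ⟨p, Fact.out⟩).adicCompletion ℚ))
  haveI : CharZero (NumberField.Place.Completion (Sum.inr ((Rat.HeightOneSpectrum.primesEquiv (R := 𝓞 ℚ)).symm ⟨p, Fact.out⟩) : NumberField.Place ℚ)) := LocalField.charZero_adicCompletion ((Rat.HeightOneSpectrum.primesEquiv (R := 𝓞 ℚ)).symm ⟨p, Fact.out⟩)
  letI : Algebra ℚ_[p] (NumberField.Place.Completion (Sum.inr ((Rat.HeightOneSpectrum.primesEquiv (R := 𝓞 ℚ)).symm ⟨p, Fact.out⟩) : NumberField.Place ℚ)) :=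
    LocalField.adicCompletionPadicAlgebra ((Rat.HeightOneSpectrum.primesEquiv (R := 𝓞 ℚ)).symm ⟨p, Fact.out⟩) p ((natCast_mem_asIdeal_iff_eq_primesEquiv_symm _ (Fact.out : p.Prime)).mpr rfl)
  haveI : Fact (¬ IsUnit ((p : ℕ) : integerC (NumberField.Place.Completion (Sum.inr ((Rat.HeightOneSpectrum.primesEquiv (R := 𝓞 ℚ)).symm ⟨p, Fact.out⟩) : NumberField.Place ℚ)))) :=
    ⟨not_isUnit_natCast_integerC (show valuation (NumberField.Place.Completion (Sum.inr ((Rat.HeightOneSpectrum.primesEquiv (R := 𝓞 ℚ)).symm ⟨p, Fact.out⟩) : NumberField.Place ℚ)) ((p : ℕ) : (NumberField.Place.Completion (Sum.inr ((Rat.HeightOneSpectrum.primesEquiv (R := 𝓞 ℚ)).symm ⟨p, Fact.out⟩) : NumberField.Place ℚ))) < 1 from LocalField.valuation_adicCompletion_natCast_lt_one ((Rat.HeightOneSpectrum.primesEquiv (R := 𝓞 ℚ)).symm ⟨p, Fact.out⟩) p ((natCast_mem_asIdeal_iff_eq_primesEquiv_symm _ (Fact.out : p.Prime)).mpr rfl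))⟩
  haveI := isAdicComplete_integerC_natCast (show valuation (NumberField.Place.Completion (Sum.inr ((Rat.HeightOneSpectrum.primesEquiv (R := 𝓞 ℚ)).symm ⟨p, Fact.out⟩) : NumberField.Place ℚ)) ((p : ℕ) : (NumberField.Place.Completion (Sum.inr ((Rat.HeightOneSpectrum.primesEquiv (R := 𝓞 ℚ)).symm ⟨p, Fact.out⟩) : NumberField.Place ℚ))) < 1 from LocalField.valuation_adicCompletion_natCast_lt_one ((Rat.HeightOneSpectrum.primesEquiv (R := 𝓞 ℚ)).symm ⟨p, Fact.out⟩) p ((natCast_mem_asIdeal_iff_eq_primesEquiv_symm _ (Fact.out : p.Prime)).mpr rfl))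
  -- the tree's `ℚ`-algebra structure on `ℚ_v` (the one W2's restricted representations are built on) is pinned
  -- as the most recent local instance, so that it — and not `DivisionRing.toRatAlgebra` — is synthesized below
  letI : Algebra ℚ (NumberField.Place.Completion (Sum.inr ((Rat.HeightOneSpectrum.primesEquiv (R := 𝓞 ℚ)).symm ⟨p, Fact.out⟩) : NumberField.Place ℚ)) := NumberField.Place.instAlgebraCompletion (Sum.inr ((Rat.HeightOneSpectrum.primesEquiv (R := 𝓞 ℚ)).symm ⟨p, Fact.out⟩) : NumberField.Place ℚ)
  ∀ (hp : p ≠ 2) (N : ℕ) (_ : NeZero N) (nf : CuspForm (Gamma0 N) 2) (_ : IsNewformOf W nf)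
    (ιcyc : (n : ℕ) → (CyclotomicField n ℚ →+* ℂ)) (q : ℚ)
    (Λv : ∀ (k : ℕ) (r : Finset (HeightOneSpectrum (𝓞 ℚ))),
      H1 (tateRep W p) (cycSubgroup p k r) →ₗ[ℤ_[p]] ℚ_[p] ⊗[ℚ] CyclotomicField (cycLevel p k r) ℚ),
    -- (A0)
    q ≠ 0 →
    -- (A1) ∧ (A2)
    (∃ d, DefinedExpStarBody W p nf d ιcyc ((q : ℚ) : ℝ) Λv ∧
      ∀ a : (NumberField.Place.Completion (Sum.inr ((Rat.HeightOneSpectrum.primesEquiv (R := 𝓞 ℚ)).symm ⟨p, Fact.out⟩) : NumberField.Place ℚ)),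
        (∃ η : contOneCocycles ρT.toTopRep, expStarCoord W (show valuation (NumberField.Place.Completion (Sum.inr ((Rat.HeightOneSpectrum.primesEquiv (R := 𝓞 ℚ)).symm ⟨p, Fact.out⟩) : NumberField.Place ℚ)) ((p : ℕ) : (NumberField.Place.Completion (Sum.inr ((Rat.HeightOneSpectrum.primesEquiv (R := 𝓞 ℚ)).symm ⟨p, Fact.out⟩) : NumberField.Place ℚ))) < 1 from LocalField.valuation_adicCompletion_natCast_lt_one ((Rat.HeightOneSpectrum.primesEquiv (R := 𝓞 ℚ)).symm ⟨p, Fact.out⟩) p ((natCast_mem_asIdeal_iff_eq_primesEquiv_symm _ (Fact.out : p.Prime)).mpr rfl)) d η = a) ↔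
          ∀ Q : (W.baseChange ℚ_[p]).toAffine.Point,
            ‖(Padic.adicCompletionEquiv (𝓞 ℚ) ⟨p, Fact.out⟩).symm
                (show ((Rat.HeightOneSpectrum.primesEquiv (R := 𝓞 ℚ)).symm ⟨p, Fact.out⟩).adicCompletion ℚ from a) * padicLogLocal W p Q‖ ≤ 1) →
    -- (A3)
    ∀ (c d₁ a : ℤ) (A : ℕ) (d' : ℤ),
      0 < A → Int.gcd c (6 * p * A) = 1 → Int.gcd d₁ (6 * p * N) = 1 → (d₁ : ℤ) * d' ≡ 1 [ZMOD (A : ℤ)] →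
      ratCuspFactor nf true c d₁ a A d' ≠ 0 →
    ∀ (z : ∀ (k : ℕ) (r : (cyclotomicLevelsRat p (badPlaces c d₁ A N)).Ideals),
        H1 (tateRep W p) ((cyclotomicLevelsRat p (badPlaces c d₁ A N)).level k r.1))
      (x : ∀ (k : ℕ) (r : (cyclotomicLevelsRat p (badPlaces c d₁ A N)).Ideals),
        CyclotomicField (cycLevel p k r.1) ℚ),
      ZetaBody W p nf ιcyc ((q : ℚ) : ℝ) Λv c d₁ a A z x →
    -- (A4) the realisation datum: the Λ-adic lift `y ∈ I.H`
    ∀ (y : I.H),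
      (∀ n : ℕ, I.proj n y =
        levelToLayer W p hκ hp (badPlaces c d₁ A N) n
          (z (n + 1) (cyclotomicLevelsRat p (badPlaces c d₁ A N)).idealOne)) →
    -- (A5′) ∧ (A6′-scalars)
    ∀ (qm perRatio : ℚ) (e : ℤ) (n₁ n₂ n₃ n₄ : ℤ) (σc σd : absoluteGaloisGroup ℚ)
      (σℓ : ℕ → absoluteGaloisGroup ℚ),
      0 < qm → AddSubgroup.closure (Set.range (ratMinusSymbol nf)) = AddSubgroup.zmultiples qm →
      ratMinusSymbol nf ((a : ℚ) / A) = n₁ * qm → ratMinusSymbol nf ((a * c : ℚ) / A) = n₂ * qm →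
      ratMinusSymbol nf ((a * d' : ℚ) / A) = n₃ * qm → ratMinusSymbol nf ((a * c * d' : ℚ) / A) = n₄ * qm →
      ((GaloisRep.cyclotomicCharacter ℚ p σc : ℤ_[p]ˣ) : ℤ_[p]) = c →
      ((GaloisRep.cyclotomicCharacter ℚ p σd : ℤ_[p]ˣ) : ℤ_[p]) = d₁ →
      (∀ ℓ ∈ A.primeFactors.erase p, ((GaloisRep.cyclotomicCharacter ℚ p (σℓ ℓ) : ℤ_[p]ˣ) : ℤ_[p]) = ℓ) →
      perRatio ≠ 0 → plusPeriod nf = ((perRatio : ℚ) : ℝ) * W.realPeriodRat →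
      padicValRat p (perRatio / (q * qm)) = e →
    -- CONCLUSION: ONE constant `p^{-t}·(α₀ + α₁φ)·w` for the frame, the endomorphism and the family …
    ∃ (t : ℕ) (α₀ α₁ : ℤ_[p]) (_ : α₀ ≠ 0 ∨ α₁ ≠ 0) (w : (IwasawaAlgebra p)ˣ),
      -- … such that for EVERY admissible twist, EVERY pinned unit tower and ALL coordinates of `[ε_𝔟]` on the `e_k` …
      (∀ 𝔟 : Ideal (𝓞 K), IsCoprime 𝔟 (Ideal.span {((6 * p * f : ℕ) : 𝓞 K)}) →
      ∀ u : F.UnitTower, (∀ s : ℕ, 1 ≤ s → IsKatoUnitRepAt p ι (Ideal.span {((f : ℕ) : 𝓞 K)}) s 𝔟 (u.z s)) →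
      ∀ (b₀ b₁ : ℤ) (Nb : ℕ), Nb ≠ 0 →
        (∀ k s : ℕ, k ≤ s → 1 ≤ s →
          (Nb : ℤ) • ((layerArtin p (Ideal.span {((f : ℕ) : 𝓞 K)}) s 𝔟 • F.e k :
              geomTorsion (W.baseChange K) ((p : ℤ) ^ k)) : geomPoints (W.baseChange K)) =
            b₀ • ((F.e k : geomTorsion (W.baseChange K) ((p : ℤ) ^ k)) : geomPoints (W.baseChange K)) +
              b₁ • φ ((F.e k : geomTorsion (W.baseChange K) ((p : ℤ) ^ k)) : geomPoints (W.baseChange K))) →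
        -- … (15.16.1) after `⊗ ℚ`: `[ε_𝔟]·(p^t M̃)·euK 𝔟 = N𝔟·([ε_𝔟] − σ_𝔟)·(α₀ + α₁φ)·w·res y` (times `N_b`), in `IK.H`
        ((b₀ : IwasawaAlgebra p) * ((p : IwasawaAlgebra p) ^ t *
            katoMultiplier p c d₁ n₁ n₂ n₃ n₄
              ((IwasawaCharacter.Psi p ℤ_[p] κ σc : (PowerSeries ℤ_[p])ˣ) : IwasawaAlgebra p)
              ((IwasawaCharacter.Psi p ℤ_[p] κ σd : (PowerSeries ℤ_[p])ˣ) : IwasawaAlgebra p)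
              (A.primeFactors.erase p) (fun ℓ => W.LFunction ℓ) (fun ℓ => if ℓ ∣ N then 0 else 1)
              (fun ℓ => ((IwasawaCharacter.Psi p ℤ_[p] κ (σℓ ℓ) : (PowerSeries ℤ_[p])ˣ) : IwasawaAlgebra p)))) •
            F.iwasawaClass u (κ.restrict K h) hV IK +
          ((b₁ : IwasawaAlgebra p) * ((p : IwasawaAlgebra p) ^ t *
            katoMultiplier p c d₁ n₁ n₂ n₃ n₄
              ((IwasawaCharacter.Psi p ℤ_[p] κ σc : (PowerSeries ℤ_[p])ˣ) : IwasawaAlgebra p)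
              ((IwasawaCharacter.Psi p ℤ_[p] κ σd : (PowerSeries ℤ_[p])ˣ) : IwasawaAlgebra p)
              (A.primeFactors.erase p) (fun ℓ => W.LFunction ℓ) (fun ℓ => if ℓ ∣ N then 0 else 1)
              (fun ℓ => ((IwasawaCharacter.Psi p ℤ_[p] κ (σℓ ℓ) : (PowerSeries ℤ_[p])ˣ) : IwasawaAlgebra p)))) •
            IK.isogenyMap φ IK hγK (F.iwasawaClass u (κ.restrict K h) hV IK) =
        ((Ideal.absNorm 𝔟 : ℕ) : IwasawaAlgebra p) •
          ((((b₀ : IwasawaAlgebra p) -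
              (Nb : IwasawaAlgebra p) * PowerSeries.binomialSeries ℤ_[p] (ZpExtension.artinExponent (κ.restrict K h) 𝔟)) •
              ((PowerSeries.C α₀ : IwasawaAlgebra p) • ((w : IwasawaAlgebra p) • I.resOver IK hγ hγK y) +
                (PowerSeries.C α₁ : IwasawaAlgebra p) •
                  IK.isogenyMap φ IK hγK ((w : IwasawaAlgebra p) • I.resOver IK hγ hγK y))) +
            (b₁ : IwasawaAlgebra p) •
              IK.isogenyMap φ IK hγK
                ((PowerSeries.C α₀ : IwasawaAlgebra p) • ((w : IwasawaAlgebra p) • I.resOver IK hγ hγK y) +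
                  (PowerSeries.C α₁ : IwasawaAlgebra p) •
                    IK.isogenyMap φ IK hγK ((w : IwasawaAlgebra p) • I.resOver IK hγ hγK y)))) ∧
      -- NEW (EXACT): Kato's (15.16.1) IS exact — the constant is a 𝔭-ADIC UNIT times `p^{e}/κ′_W` ((★E) of the module
      -- docstring), stated in NORM form: `v_p(Nm(α₀ + α₁φ)) = 2t + 2e − v_p(Nm_{K/ℚ} κ′_W)`
      (((α₀ ^ 2 + (p : ℤ_[p]) * α₁ ^ 2).valuation : ℕ) : ℤ) = 2 * (t : ℤ) + 2 * e - padicValRat p (Algebra.norm ℚ κ')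

end CM

end Literature.NumberTheory.EllipticCurves.Kato2004

end
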